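import Summits.AtomisticToContinuum.Crystallization.Theorems.PalmUnimodularRigidityShellsToBarlowChartDefs
import Summits.AtomisticToContinuum.Crystallization.Theorems.PalmUnimodularRigidityShellsToBarlowChartPowerTranslationA
import Summits.AtomisticToContinuum.Crystallization.Theorems.PalmUnimodularRigidityShellsToBarlowChartPowerTranslationT
import Summits.AtomisticToContinuum.Crystallization.Theorems.PalmUnimodularRigidityShellsToBarlowChartPowerTranslationB

/-!
# Stub `stub_powerTranslation` of line `develop-the-model-growth-descent` (crux `ShellsToBarlowChart`, stmt-AtomisticToContinuum-9227)

## Worker log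
* (R) rigidity `contactAut_eq_isometry` — file `…PowerTranslationA.lean` (rc 0, 395 lines);
* (T) torsion `isometry_finiteOrder_shortMove` (model fact `pt_near_two`, covering radius,
  centroid fixed point) — file `…PowerTranslationT.lean` (rc 0, 263 lines);
* (B) Bieberbach `isometry_pow_eq_translation` — file `…PowerTranslationB.lean` (rc 0, 176 lines);
* this file: the registered stub, assembled from the three (rc 0 against the inlined defs in
  `work/stubs/scratch_all.lean`; axioms `propext, Classical.choice, Quot.sound`).

A contact automorphism `σ` of the ideal stacking `B = barlowStacking 1 √(2/3) s` moving every
site by graph distance `≥ 3` has a power `σ^[n]` equal on `B` to the translation by a non-zero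
two-sided period `τ` of `B`: `σ` is the restriction of an isometry `g` of `ℝ³` (rigidity of the
FCC/HCP stars, Hales 2012 Lemma 10, propagated along the connected contact graph); a power
`g ^ n = 1`, `n ≥ 1`, would fix the centroid of an orbit and hence move the nearest site by
Euclidean distance `< 2`, i.e. by graph distance `≤ 2` — excluded; so the linear part of `g`,
which permutes the finite spanning set of bond vectors, has a positive power equal to the
identity, and that power of `g` is a non-zero translation.
-/

noncomputable section

namespace Summit.AtomisticToContinuum.Crystallization.Theorems.PalmUnimodularRigidityShellsToBarlowChart

open Literature.Geometry.DiscreteGeometry Literature.MathematicalPhysics.StatisticalMechanics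
open Summit.AtomisticToContinuum.Crystallization.Theorems.ShellsToBarlowChartNegative

/-- Euclidean `3`-space. -/
local notation "E3" => EuclideanSpace ℝ (Fin 3)

/-! ## The stub: a power of a site-free deck automorphism is a non-zero two-sided period -/

/-- **stub 4 of line `develop-the-model-growth-descent` — torsion + Bieberbach on the model.**
A contact automorphism `σ` of the ideal stacking `B = barlowStacking 1 √(2/3) s` moving every
site by graph distance `≥ 3` (no fixed site, no site moved to a contact, no site moved to a
contact of a contact) has a power `σ^[n]` which is the translation by a non-zero two-sided period
`τ` of `B`.  Proof: `σ` is the restriction of an isometry `g` (`contactAut_eq_isometry`); no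
positive power of `g` is the identity (a finite-order `g` would move some site by graph distance
`≤ 2`, `isometry_finiteOrder_shortMove`); hence some positive power of `g` is a non-zero
translation (`isometry_pow_eq_translation`). [folklore] -/
theorem stub_powerTranslation :
    ∀ (s : ℤ → ℤ) (σ : E3 → E3), IsHaggSeq s → IsContactAut s σ →
      (∀ q ∈ barlowStacking 1 (Real.sqrt (2 / 3)) s, σ q ≠ q) →
      (∀ q ∈ barlowStacking 1 (Real.sqrt (2 / 3)) s, dist q (σ q) ≠ 1) →
      (∀ q ∈ barlowStacking 1 (Real.sqrt (2 / 3)) s, ∀ m ∈ barlowStacking 1 (Real.sqrt (2 / 3)) s, dist q m = 1 → dist m (σ q) ≠ 1) →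
        ∃ τ : E3, τ ≠ 0 ∧ (∀ q ∈ barlowStacking 1 (Real.sqrt (2 / 3)) s, q + τ ∈ barlowStacking 1 (Real.sqrt (2 / 3)) s ∧ q - τ ∈ barlowStacking 1 (Real.sqrt (2 / 3)) s) ∧
          ∃ n : ℕ, ∀ q ∈ barlowStacking 1 (Real.sqrt (2 / 3)) s, σ^[n] q = q + τ := by
  intro s σ hs hσ h0 h1 h2
  obtain ⟨hbij, hcontact⟩ := hσ
  obtain ⟨g, hg⟩ := contactAut_eq_isometry s σ hs hbij hcontact
  have hgB : ∀ p ∈ barlowStacking 1 (Real.sqrt (2 / 3)) s,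
      g p ∈ barlowStacking 1 (Real.sqrt (2 / 3)) s := fun p hp => by
    rw [hg p hp]; exact hbij.mapsTo hp
  -- no positive power of `g` is the identity
  have hng : ∀ n : ℕ, 1 ≤ n → g ^ n ≠ 1 := by
    intro n hn hgn
    obtain ⟨p, hp, h⟩ := isometry_finiteOrder_shortMove s hs g hgB n hn hgn
    rw [hg p hp] at h
    rcases h with h | h | ⟨r, hr, hpr, hrσ⟩
    · exact h0 p hp h
    · exact h1 p hp h
    · exact h2 p hp r hr hpr hrσ
  obtain ⟨m, -, v, hv, hgm⟩ := isometry_pow_eq_translation s hs g hgB hng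
  -- powers of `g` are the iterates of `σ` on the model
  have hiter : ∀ n : ℕ, ∀ q ∈ barlowStacking 1 (Real.sqrt (2 / 3)) s,
      σ^[n] q ∈ barlowStacking 1 (Real.sqrt (2 / 3)) s ∧ (g ^ n) q = σ^[n] q := by
    intro n
    induction n with
    | zero => intro q hq; exact ⟨hq, by simp⟩
    | succ n ih =>
      intro q hq
      obtain ⟨hq', he⟩ := ih q hq
      refine ⟨?_, ?_⟩
      · rw [Function.iterate_succ_apply']; exact hbij.mapsTo hq'
      · rw [Function.iterate_succ_apply', pow_succ', IsometryEquiv.mul_apply, he, hg _ hq']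
  -- powers of `g` are onto the model
  have hsurj : ∀ n : ℕ, ∀ q ∈ barlowStacking 1 (Real.sqrt (2 / 3)) s,
      ∃ p ∈ barlowStacking 1 (Real.sqrt (2 / 3)) s, (g ^ n) p = q := by
    intro n
    induction n with
    | zero => intro q hq; exact ⟨q, hq, by simp⟩
    | succ n ih =>
      intro q hq
      obtain ⟨q₁, hq₁, rfl⟩ := hbij.surjOn hq
      obtain ⟨p, hp, hpq⟩ := ih q₁ hq₁
      exact ⟨p, hp, by rw [pow_succ', IsometryEquiv.mul_apply, hpq, hg _ hq₁]⟩
  refine ⟨v, hv, fun q hq => ⟨?_, ?_⟩, m, fun q hq => ?_⟩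
  · obtain ⟨hmem, he⟩ := hiter m q hq
    rw [← hgm q, he]
    exact hmem
  · obtain ⟨p, hp, hpq⟩ := hsurj m q hq
    rw [hgm p] at hpq
    rw [← eq_sub_of_add_eq hpq]
    exact hp
  · rw [← (hiter m q hq).2, hgm q]

end Summit.AtomisticToContinuum.Crystallization.Theorems.PalmUnimodularRigidityShellsToBarlowChart

end
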